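import Summits.QuantumFields.BalabanUV.T4Continuum.Spine.NE1p.DressedRoot
import Summits.QuantumFields.BalabanUV.T4Continuum.Support.T4TrajectoryDensityGatedNull

/-!
# T⁴ programme, spine estimate NE1′ (node O3b/H2) — END-F-null: THE TRANSPORT LEAF `htr` WITH LEAF F-3's INTERIOR-POINT CLAUSE
# MADE CONDITIONAL (own-initiative supplier «F3-NULL» of the NE1′ formalisation swarm, under the locator row S6)

Cell `pub-balaban`, sub-cell `t4`, BINDER-OWNERS row NE1′ (owner lineage t4-ne1p-p1, root `Spine/NE1p/DressedRoot.lean` p211416);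
swarm unit `b2b-balaban-t4-ne1p-formalise-leaf-02` (INTENT HOME/CLAIMS.log 2026-08-20T08:53:18Z; locator
`t4/b2b-balaban-t4-ne1p-formalise-leaf-02/XREAD-F3-B16-sigma.md` §2 (d4), HOME/GAPS.md C-ne1pleaf02-1); tree target
`Summits/QuantumFields/BalabanUV/T4Continuum/Spine/NE1p/`; ADDITIVE — imports `Spine/NE1p/DressedRoot` and
`Support/T4TrajectoryDensityGatedNull` ONLY, modifies nothing.

WHAT THIS FILE DOES.  END-F (`DressedRoot.transportLeaf_of_centredExponent`) displays, inside leaf F-3's binder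
`hB : RealBaseAt (ref b k) (base b k) (𝒜 b k) (μ b k) (𝒦 b k′ (k+1))`, the clause `0 < μ b k (support (base b k))` — an interior point
of the met step's real constraint set.  Of F-3's clauses it is the one that is NOT IN PRINT as a statement: [Balaban1989LargeFieldII]
p. 380 asserts it («The expression 𝐓′_k(X,(U,0))1 is obviously positive, although it may be very small»), [Balaban1989LargeFieldI]
p. 176 promised it, the cell's GAPS G-adv3-2a locates the half-page domain lemma, and G-B16-16 shows it is load-bearing for NO
printed inequality (a null domain makes the operation's summand vanish identically).  **END-F-null**
`transportLeaf_of_centredExponent_null` is END-F VERBATIM except: `hB` is asked only where the constraint set carries mass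
(`μ b k (Function.support (base b k)) ≠ 0`), and `hD : (D b k).Nonempty` is replaced by `hz₀ : z₀ b k ∈ D b k` (the junk point of
the totalised operation `wOp` lies in the fluctuation domain).  On a null window `wOp` is evaluation at `z₀ b k` for EVERY
background and the operator slice is free (`T4TrajectoryDensityGatedNull.opSliceOn_wOp_of_null`); conclusion VERBATIM the field
type of `BookingLeaves.htr` with `C = 4c_δ/r`, `ρ i = ψ·α i`, gate `budgetGate …`, `hs` discharged by `hs_of_budgetGate`.
EFFECT ON THE WALL'S CITATION STATUS (locator §3, trigger c3∕c4): F-3's `hB` now carries UNCONDITIONALLY only clauses of DISPLAYED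
TYPE (base `≥ 0` a.e., reality ∕ measurability ∕ integrability at the reference — pp. 379–380), and the unprinted interior-point
clause only for PRESENT terms, exactly as print uses it; THE NUMBER (`hE`'s margin `s b k`) is untouched.

HONEST FRAMING.  Rung (B)+1 bookkeeping on ONE finite four-torus of fixed physical size — NOT infinite volume, NOT a mass gap, NOT
OS on ℝ⁴, NOT the Clay problem, NOT summit progress.  NE1′ is NOT PRINTED and NOT PROVED; headline «L-T ⇐ F-1…F-9 with F-3's
interior point asked only on present windows», never «NE1′ proved»; 0 binders instantiated on Bałaban's densities; no `def`, no
`def … : Prop`; nothing of [Balaban1989LargeFieldII] asserted.  [folklore] kernel glue, 0 sorry, 0 citations used as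
hypothesis-free facts.  Spine PROVED 0∕9 unchanged.  HONEST DEPENDENCY: continuum YM on T⁴ ⇐ BetaPertH ∧ nine spine estimates
(0/9 proved); BetaPertH ⇐ (D1) ∧ (D4) ∧ CAP+tail; G-an2-4 gates asym, D1 and NE2/3/4.
-/

noncomputable section

namespace Summit.QuantumFields.BalabanUV.T4Continuum.NE1p.DressedRootNull

open Finset
open scoped BigOperators
open MeasureTheory Set Metric
open Literature.MathematicalPhysics.QuantumFieldTheory.Balaban1983to89
open Literature.MathematicalPhysics.QuantumFieldTheory.Balaban1983to89.T4TermFormat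
open Literature.MathematicalPhysics.QuantumFieldTheory.Balaban1983to89.T4GatedBooking
open Literature.MathematicalPhysics.QuantumFieldTheory.Balaban1983to89.T4TrajectoryComparison
open T4BirthChartTransport (GaugeInvariant BirthSlice RelGauge)
open T4BlockTransport (Fld NDir latMove latN)
open T4TrajectoryDensity
open Summit.QuantumFields.BalabanUV.T4Continuum.T4TrajectoryDensityDressed
open Summit.QuantumFields.BalabanUV.T4Continuum.NE1p.DressedRoot

variable {B : T4TermFormat.Booking} {T : Trajectory B}
variable {R : Type*} [NormedRing R] [NormedAlgebra ℂ R] [MeasurableSpace R] {d : ℕ}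
  {F : Type*} [NormedAddCommGroup F] [NormedSpace ℂ F] [CompleteSpace F]

/-- **END-F-null — THE TRANSPORT LEAF `htr`, GATED BY THE DRESSED BUDGET, INTERIOR-POINT CLAUSE CONDITIONAL** [bookkeeping]:
`DressedRoot.transportLeaf_of_centredExponent` (END-F, p211416) VERBATIM except (i) leaf F-3's real regular base
`hB : … → RealBaseAt (ref b k) (base b k) (𝒜 b k) (μ b k) (𝒦 b k′ (k+1))` is asked only under
`μ b k (Function.support (base b k)) ≠ 0` — where the met step's constraint set carries fluctuation mass, i.e. where the term is
PRESENT (on a null window the dressed step is evaluation at `z₀ b k`, background-free); (ii) `hD : (D b k).Nonempty` becomes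
`hz₀ : z₀ b k ∈ D b k`.  Proof: `T4TrajectoryDensityGatedNull.transportsFromVar_of_centredExponent_lattice_fam_gated_null` with
`Gate := budgetGate …`, `s₁ b k := m·Σ_{f∈S k b} envVar …`, `hs := hs_of_budgetGate`.  Conclusion: EXACTLY the field `htr` of
`BookingLeaves` with `C = 4c_δ/r`, `ρ i = ψ·α i`.  Every wall binder — (w1) `hsl`, H2 `hFn`/`h𝒢`, (w2-act) `hB` (conditional) /
`hE` (THE NUMBER `s b k`, printed TYPE [Balaban1989LargeFieldII] (1.65) p. 375, (1.71)–(1.75) pp. 379–380, asserted for Bałaban's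
densities NOWHERE), `hP`, (w3)⁺ `hN1`/`hN2`/`hdiam`/`hθ`, (w4) `hdom`, (I4′) `hdefw`/`hrate`, `hlin`, `hinv`, `hDμ` — stays
displayed; nothing of Bałaban's densities is asserted. [folklore] -/
theorem transportLeaf_of_centredExponent_null {Fn : B.Birth → ℕ → ℕ → Fld d R → F}
    {rel : B.Birth → ℕ → ℕ → Fld d R → Fld d R → Prop} {𝒦 : B.Birth → ℕ → ℕ → Set (Fld d R)}
    {ref : B.Birth → ℕ → Fld d R → Fld d R} {base : B.Birth → ℕ → Fld d R → ℝ}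
    {𝒜 𝒬 : B.Birth → ℕ → Fld d R → Fld d R → ℂ} {q : B.Birth → ℕ → Fld d R → ℂ}
    {μ : B.Birth → ℕ → Measure (Fld d R)} {z₀ : B.Birth → ℕ → Fld d R} {D : B.Birth → ℕ → Set (Fld d R)}
    {defect : B.Birth → ℕ → ℕ → ℝ} {cδ ψ w r m : ℝ} {s θ : B.Birth → ℕ → ℝ} {α : ℕ → ℝ}
    {ϱ : B.Birth → ℕ → ℕ → ℝ} {S : ℕ → B.Birth → Finset B.Birth}
    (hα : ∀ i, 0 ≤ α i) (hr : 0 < r) (hw : 0 < w)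
    (hsl : ∀ (b : B.Birth) (k' : ℕ), B.birthScale b ≤ k' → k' ≤ B.K →
      RanBelow (budgetGate T s m S (4 * cδ / r) (fun i => ψ * α i)) k' →
      BirthSlice (Fn b k' k') latMove latN (𝒦 b k' k') w r (T.gen b k'))
    (hFn : ∀ (b : B.Birth) (k' k : ℕ), B.birthScale b ≤ k' → k' ≤ k → k + 1 ≤ B.K →
      RanBelow (budgetGate T s m S (4 * cδ / r) (fun i => ψ * α i)) (k + 1) →
      ∀ U, Fn b k' (k + 1) U =
        wOp (expWeight (base b k) (𝒜 b k + 𝒬 b k)) (μ b k) (z₀ b k) U (fun z => Fn b k' k (U + z)))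
    (h𝒢 : ∀ (b : B.Birth) (k' k : ℕ), B.birthScale b ≤ k' → k' ≤ k → k + 1 ≤ B.K →
      RanBelow (budgetGate T s m S (4 * cδ / r) (fun i => ψ * α i)) (k + 1) →
      ∀ U, (fun z => Fn b k' k (U + z)) ∈ BddClass F (μ b k))
    (hz₀ : ∀ b k, z₀ b k ∈ D b k) (hϱ : ∀ b k' k, 0 < ϱ b k' k)
    (hB : ∀ (b : B.Birth) (k' k : ℕ), B.birthScale b ≤ k' → k' ≤ k → k + 1 ≤ B.K →
      RanBelow (budgetGate T s m S (4 * cδ / r) (fun i => ψ * α i)) (k + 1) →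
      μ b k (Function.support (base b k)) ≠ 0 →
      RealBaseAt (ref b k) (base b k) (𝒜 b k) (μ b k) (𝒦 b k' (k + 1)))
    (hE : ∀ (b : B.Birth) (k' k : ℕ), B.birthScale b ≤ k' → k' ≤ k → k + 1 ≤ B.K →
      RanBelow (budgetGate T s m S (4 * cδ / r) (fun i => ψ * α i)) (k + 1) →
      ExponentSliceAt (ref b k) (𝒜 b k) (μ b k) latMove latN (𝒦 b k' (k + 1)) w (ϱ b k' k) (s b k))
    (hP : ∀ (b : B.Birth) (k' k : ℕ), B.birthScale b ≤ k' → k' ≤ k → k + 1 ≤ B.K →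
      RanBelow (budgetGate T s m S (4 * cδ / r) (fun i => ψ * α i)) (k + 1) →
      PertSlice (fun U z => 𝒬 b k U z - q b k U) (μ b k) latMove latN (𝒦 b k' (k + 1)) w (ϱ b k' k)
        (m * ∑ f ∈ S k b, T.envVar (4 * cδ / r) (fun i => ψ * α i) f k))
    (hDμ : ∀ b k, ∀ᵐ z ∂μ b k, z ∈ D b k)
    (hN1 : ∀ (b : B.Birth) (k' k : ℕ), B.birthScale b ≤ k' → k' ≤ k → k + 1 ≤ B.K →
      ∀ z ∈ D b k, ∀ U ∈ 𝒦 b k' (k + 1), U + z ∈ 𝒦 b k' k)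
    (hN2 : ∀ (b : B.Birth) (k' k : ℕ), B.birthScale b ≤ k' → k' ≤ k → k + 1 ≤ B.K →
      ∀ U₀ ∈ 𝒦 b k' (k + 1), ∀ p : NDir d R, latN p ≤ w → ∀ z' ∈ D b k, latMove U₀ p 1 + z' ∈ 𝒦 b k' k)
    (hdiam : ∀ b k, ∀ z ∈ D b k, ∀ z' ∈ D b k, ∀ x ν, ‖z x ν - z' x ν‖ ≤ θ b k)
    (hθ : ∀ b k, 0 < θ b k ∧ θ b k ≤ w)
    (hdom : ∀ (b : B.Birth) (k' k : ℕ), B.birthScale b ≤ k' → k' ≤ k → k + 1 ≤ B.K →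
      Real.exp 3 * (1 + 4 * θ b k / ϱ b k' k) ≤ α k)
    (hinv : ∀ b k' k, GaugeInvariant (rel b k' k) (Fn b k' k))
    (hdefw : ∀ b k' k, defect b k' k ≤ w)
    (hrate : ∀ (b : B.Birth) (k' k : ℕ), B.birthScale b ≤ k' → k' ≤ k → k ≤ B.K →
      defect b k' k ≤ cδ * ψ ^ (k - k'))
    (hlin : ∀ (b : B.Birth) (k' k : ℕ), B.birthScale b ≤ k' → k' ≤ k → k ≤ B.K →
      RanBelow (budgetGate T s m S (4 * cδ / r) (fun i => ψ * α i)) k → ∀ ε > 0,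
      ∃ U₀ ∈ 𝒦 b k' k, ∃ U₁ : Fld d R, RelGauge (rel b k' k) latMove latN U₀ U₁ (defect b k' k) ∧
        T.lin b k' k ≤ ‖Fn b k' k U₁ - Fn b k' k U₀‖ + ε) :
    T.TransportsFromVar (4 * cδ / r) (fun i => ψ * α i) (budgetGate T s m S (4 * cδ / r) (fun i => ψ * α i)) :=
  transportsFromVar_of_centredExponent_lattice_fam_gated_null
    (Gate := budgetGate T s m S (4 * cδ / r) (fun i => ψ * α i))
    (s₁ := fun b k => m * ∑ f ∈ S k b, T.envVar (4 * cδ / r) (fun i => ψ * α i) f k)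
    hα hr hw hsl hFn h𝒢 hz₀ hϱ hB hE hP (hs_of_budgetGate (T := T)) hDμ hN1 hN2 hdiam hθ hdom hinv hdefw hrate hlin

omit [NormedRing R] [NormedAlgebra ℂ R] in
/-- **END-F IS THE SPECIAL CASE** [bookkeeping]: END-F's unconditional `hB` gives END-F-null's conditional one by discarding the
mass hypothesis — so END-F-null is END-F with one clause weakened and `hD ↦ hz₀`, nothing else. [folklore] -/
theorem hB_null_of_hB {𝒦 : B.Birth → ℕ → ℕ → Set (Fld d R)} {ref : B.Birth → ℕ → Fld d R → Fld d R}
    {base : B.Birth → ℕ → Fld d R → ℝ} {𝒜 : B.Birth → ℕ → Fld d R → Fld d R → ℂ} {μ : B.Birth → ℕ → Measure (Fld d R)}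
    {Gate : ℕ → Prop}
    (hB : ∀ (b : B.Birth) (k' k : ℕ), B.birthScale b ≤ k' → k' ≤ k → k + 1 ≤ B.K → RanBelow Gate (k + 1) →
      RealBaseAt (ref b k) (base b k) (𝒜 b k) (μ b k) (𝒦 b k' (k + 1))) :
    ∀ (b : B.Birth) (k' k : ℕ), B.birthScale b ≤ k' → k' ≤ k → k + 1 ≤ B.K → RanBelow Gate (k + 1) →
      μ b k (Function.support (base b k)) ≠ 0 →
      RealBaseAt (ref b k) (base b k) (𝒜 b k) (μ b k) (𝒦 b k' (k + 1)) :=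
  fun b k' k h₁ h₂ h₃ h₄ _ => hB b k' k h₁ h₂ h₃ h₄

end Summit.QuantumFields.BalabanUV.T4Continuum.NE1p.DressedRootNull

end
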